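import Summits.CriticalPhenomena.CardyFormulaZ2.Theorems.CardyIKTransportIKLinearTransportCouplingLift

/-!
# `stub_LinearTransport` (crux stmt-CriticalPhenomena-5076, line `pinned-diagram-exchange`) — RESHAPE,
# part 3 of 4: the coupling lift, Part B — gluing along the finite window data; piece S₃ `couplingLift`

Support file (`--supports stmt-CriticalPhenomena-5076`, registered sub-goal `couplingLift`) of the reshape
`stub_LinearTransport = stripLaw (S₁) → windowTransport (S₂, open) → couplingLift (S₃)` (see the header of
`…TransportDefs`).

PIECE S₃ · `couplingLift` (PROVED here) — LIFT OF AN OBSERVABLE COUPLING TO THE GAUGE: for `K, ε, ρ` there is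
a block scale `A > 0` (`Lift.liftScale K ε ρ`) such that for every mesh `0 < δ ≤ 1`, every pair of column
patterns `S₀, S₁` whose observables have the window laws of `S = univ`, resp. `S = ∅`, on the sup-ball of
radius `⌈A/δ⌉` (which the strip law `stripLaw` provides for block patterns), and every coupling `π` of
`ν_{S₀}` with `ν_{S₁}`, some coupling `γ` of `μIK` with `μIK` has `γ (badPair K δ ε ρ) ≤ π (badObs K δ ε ρ)`.

The window data is FINITE, so the lift is conditioning on a finite partition and no disintegration /
standard-Borel machinery is needed (`Lift.glue`): with the fibres `fib w` of `Obs` over the admissible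
window data `w ∈ winData Λf` (pairs of subsets of the finite window `Λf`), `t₀ w = (obs univ)⁻¹' fib w`,
`t₁ w = (obs ∅)⁻¹' fib w`,

  `γ := Σ_{(w,w')} π(fib w × fib w') · (μIK(t₀ w) μIK(t₁ w'))⁻¹ • (μIK|t₀ w) ⊗ (μIK|t₁ w')`;

its marginals are `μIK` because `Σ_{w'} π(fib w × fib w') = ν_{S₀}(fib w) = ν_univ(fib w) = μIK(t₀ w)`
(window-law hypothesis) and the fibres partition (`sum_measure_fib`); on `t₀ w × t₁ w'` the event `badPair`
is constant (`Lift.badObs_congr`, previous file), so each term is `≤ (π|badObs)(fib w × fib w')` and the sum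
is `π(badObs)`. `badPair` need not be measurable for this (outer measure bound through the measurable
product fibres).
-/

noncomputable section

namespace Summit.CriticalPhenomena.CardyFormulaZ2.Theorems.IKLinearTransport.PinnedDiagramExchange

open scoped BigOperators Topology Classical MeasureTheory ProbabilityTheory ENNReal
open Filter Set Function MeasureTheory
open Literature.Probability.Percolation Literature.Probability.LatticeModels
open Literature.Probability.RandomPlanarGeometry

/-! ## The lift, Part B — gluing along the finite window data -/

namespace Lift

section Glue

variable (Λf : Finset (Site 2))

/-- The admissible window data: pairs of subsets of `Λf`. [folklore] -/
def winData : Finset (Finset (Site 2) × Finset (Site 2)) := Λf.powerset ×ˢ Λf.powerset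

/-- The fibre of observable configurations with window data `w` on `Λf`. [folklore] -/
def fib (w : Finset (Site 2) × Finset (Site 2)) : Set Obs :=
  ⋂ v ∈ Λf, {x : Obs | (v ∈ x.1 ↔ v ∈ w.1) ∧ (v ∈ x.2 ↔ v ∈ w.2)}

/-- Membership in a fibre. [folklore] -/
theorem mem_fib {w : Finset (Site 2) × Finset (Site 2)} {x : Obs} :
    x ∈ fib Λf w ↔ ∀ v ∈ Λf, (v ∈ x.1 ↔ v ∈ w.1) ∧ (v ∈ x.2 ↔ v ∈ w.2) := by
  simp only [fib, Set.mem_iInter, Set.mem_setOf_eq]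

/-- The window data of a configuration. [folklore] -/
def res (x : Obs) : Finset (Site 2) × Finset (Site 2) := (Λf.filter (· ∈ x.1), Λf.filter (· ∈ x.2))

/-- The window data is admissible. [folklore] -/
theorem res_mem (x : Obs) : res Λf x ∈ winData Λf := by
  simp only [res, winData, Finset.mem_product, Finset.mem_powerset]
  exact ⟨Finset.filter_subset _ _, Finset.filter_subset _ _⟩

/-- A configuration lies in the fibre of its window data. [folklore] -/
theorem mem_fib_res (x : Obs) : x ∈ fib Λf (res Λf x) := by
  rw [mem_fib]
  intro v hv
  simp only [res, Finset.mem_filter, hv, true_and, iff_self, and_self]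

/-- Two admissible window data with a common configuration are equal. [folklore] -/
theorem eq_of_mem_fib {w w' : Finset (Site 2) × Finset (Site 2)} (hw : w ∈ winData Λf)
    (hw' : w' ∈ winData Λf) {x : Obs} (hx : x ∈ fib Λf w) (hx' : x ∈ fib Λf w') : w = w' := by
  rw [mem_fib] at hx hx'
  simp only [winData, Finset.mem_product, Finset.mem_powerset] at hw hw'
  refine Prod.ext (Finset.ext fun v => ?_) (Finset.ext fun v => ?_)
  · by_cases hv : v ∈ Λf
    · exact (hx v hv).1.symm.trans (hx' v hv).1
    · exact ⟨fun h => (hv (hw.1 h)).elim, fun h => (hv (hw'.1 h)).elim⟩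
  · by_cases hv : v ∈ Λf
    · exact (hx v hv).2.symm.trans (hx' v hv).2
    · exact ⟨fun h => (hv (hw.2 h)).elim, fun h => (hv (hw'.2 h)).elim⟩

/-- Fibres are measurable. [folklore] -/
theorem measurableSet_fib (w : Finset (Site 2) × Finset (Site 2)) : MeasurableSet (fib Λf w) := by
  refine Finset.measurableSet_biInter Λf fun v _ => ?_
  have h1 : Measurable fun x : Obs => v ∈ x.1 := (measurable_set_mem v).comp measurable_fst
  have h2 : Measurable fun x : Obs => v ∈ x.2 := (measurable_set_mem v).comp measurable_snd
  exact measurableSet_setOf.2 ((measurable_iff_const h1 _).and (measurable_iff_const h2 _))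

/-- Fibres are determined by `Λf`. [folklore] -/
theorem fib_mem_determinedOn (w : Finset (Site 2) × Finset (Site 2)) :
    fib Λf w ∈ determinedOn (↑Λf : Set (Site 2)) := by
  intro x y hxy
  rw [mem_fib, mem_fib]
  refine forall₂_congr fun v hv => ?_
  rw [(hxy v hv).1, (hxy v hv).2]

/-- Two configurations in a common fibre agree on `Λf`. [folklore] -/
theorem agree_of_mem_fib {w : Finset (Site 2) × Finset (Site 2)} {x y : Obs} (hx : x ∈ fib Λf w)
    (hy : y ∈ fib Λf w) : Agree (↑Λf : Set (Site 2)) x y := by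
  rw [mem_fib] at hx hy
  exact fun v hv => ⟨(hx v hv).1.trans (hy v hv).1.symm, (hx v hv).2.trans (hy v hv).2.symm⟩

/-- PARTITION: the fibres of the admissible window data partition `Obs`. [folklore] -/
theorem sum_measure_fib (μ : Measure Obs) : ∑ w ∈ winData Λf, μ (fib Λf w) = μ Set.univ := by
  rw [← measure_biUnion_finset]
  · congr 1
    exact Set.eq_univ_of_forall fun x => Set.mem_iUnion₂.2 ⟨res Λf x, res_mem Λf x, mem_fib_res Λf x⟩
  · intro w hw w' hw' hne
    exact Set.disjoint_left.2 fun x hx hx' => hne (eq_of_mem_fib Λf hw hw' hx hx')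
  · exact fun w _ => measurableSet_fib Λf w

/-- PARTITION of `Obs × Obs` by products of fibres. [folklore] -/
theorem sum_measure_fib_prod (μ : Measure (Obs × Obs)) :
    ∑ w ∈ winData Λf ×ˢ winData Λf, μ (fib Λf w.1 ×ˢ fib Λf w.2) = μ Set.univ := by
  rw [← measure_biUnion_finset]
  · congr 1
    refine Set.eq_univ_of_forall fun xx => Set.mem_iUnion₂.2 ⟨(res Λf xx.1, res Λf xx.2),
      Finset.mem_product.2 ⟨res_mem _ _, res_mem _ _⟩, Set.mk_mem_prod (mem_fib_res _ _) (mem_fib_res _ _)⟩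
  · intro w hw w' hw' hne
    refine Set.disjoint_left.2 fun xx hx hx' => hne ?_
    obtain ⟨hw1, hw2⟩ := Finset.mem_product.1 hw
    obtain ⟨hw1', hw2'⟩ := Finset.mem_product.1 hw'
    exact Prod.ext (eq_of_mem_fib Λf hw1 hw1' hx.1 hx'.1) (eq_of_mem_fib Λf hw2 hw2' hx.2 hx'.2)
  · exact fun w _ => (measurableSet_fib Λf w.1).prod (measurableSet_fib Λf w.2)

/-- Row sums over the fibres. [folklore] -/
theorem sum_measure_fib_row (μ : Measure (Obs × Obs)) (A : Set Obs) :
    ∑ w ∈ winData Λf, μ (A ×ˢ fib Λf w) = μ (A ×ˢ Set.univ) := by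
  have key := sum_measure_fib Λf ((μ.restrict (A ×ˢ Set.univ)).map Prod.snd)
  have hmap : ∀ w, ((μ.restrict (A ×ˢ Set.univ)).map Prod.snd) (fib Λf w) = μ (A ×ˢ fib Λf w) := by
    intro w
    rw [Measure.map_apply measurable_snd (measurableSet_fib Λf w),
      Measure.restrict_apply (measurable_snd (measurableSet_fib Λf w))]
    congr 1
    ext xx
    simp only [Set.mem_inter_iff, Set.mem_preimage, Set.mem_prod, Set.mem_univ, and_true]
    tauto
  have huniv : ((μ.restrict (A ×ˢ Set.univ)).map Prod.snd) Set.univ = μ (A ×ˢ Set.univ) := by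
    rw [Measure.map_apply measurable_snd MeasurableSet.univ, Set.preimage_univ, Measure.restrict_apply_univ]
  simpa only [hmap, huniv] using key

/-- Column sums over the fibres. [folklore] -/
theorem sum_measure_fib_col (μ : Measure (Obs × Obs)) (A : Set Obs) :
    ∑ w ∈ winData Λf, μ (fib Λf w ×ˢ A) = μ (Set.univ ×ˢ A) := by
  have key := sum_measure_fib Λf ((μ.restrict (Set.univ ×ˢ A)).map Prod.fst)
  have hmap : ∀ w, ((μ.restrict (Set.univ ×ˢ A)).map Prod.fst) (fib Λf w) = μ (fib Λf w ×ˢ A) := by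
    intro w
    rw [Measure.map_apply measurable_fst (measurableSet_fib Λf w),
      Measure.restrict_apply (measurable_fst (measurableSet_fib Λf w))]
    congr 1
    ext xx
    simp only [Set.mem_inter_iff, Set.mem_preimage, Set.mem_prod, Set.mem_univ, true_and]
  have huniv : ((μ.restrict (Set.univ ×ˢ A)).map Prod.fst) Set.univ = μ (Set.univ ×ˢ A) := by
    rw [Measure.map_apply measurable_fst MeasurableSet.univ, Set.preimage_univ, Measure.restrict_apply_univ]
  simpa only [hmap, huniv] using key

/-- **GLUING ALONG THE WINDOW DATA**: a coupling `π` of `ν_{S₀}` with `ν_{S₁}` whose marginals have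
the window laws of `S = univ`, resp. `S = ∅`, on `Λf` lifts to a coupling `γ` of `μIK` with `μIK`, and
every event of pairs read on `Λf × Λf` has `γ`-mass (through `(obs univ, obs ∅)`) at most its `π`-mass.
[folklore] -/
theorem glue {S₀ S₁ : Set ℤ} {π : Measure (Obs × Obs)}
    (h1 : π.map Prod.fst = νmix S₀) (h2 : π.map Prod.snd = νmix S₁)
    (hw₀ : ∀ E : Set Obs, MeasurableSet E → E ∈ determinedOn (↑Λf : Set (Site 2)) →
      νmix S₀ E = νmix Set.univ E)
    (hw₁ : ∀ E : Set Obs, MeasurableSet E → E ∈ determinedOn (↑Λf : Set (Site 2)) →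
      νmix S₁ E = νmix ∅ E)
    {B : Set (Obs × Obs)}
    (hB : ∀ x y x' y' : Obs, Agree ↑Λf x y → Agree ↑Λf x' y' → ((x, x') ∈ B ↔ (y, y') ∈ B)) :
    ∃ γ : Measure (Ω × Ω), γ.map Prod.fst = μIK ∧ γ.map Prod.snd = μIK ∧
      γ ((fun ωω' : Ω × Ω => (obs Set.univ ωω'.1, obs ∅ ωω'.2)) ⁻¹' B) ≤ π B := by
  haveI := CouplingToLimits.isProbabilityMeasure_μIK
  set P := winData Λf with hP
  set F : Finset (Site 2) × Finset (Site 2) → Set Obs := fib Λf with hF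
  set t₀ : Finset (Site 2) × Finset (Site 2) → Set Ω := fun w => obs Set.univ ⁻¹' F w with ht₀
  set t₁ : Finset (Site 2) × Finset (Site 2) → Set Ω := fun w => obs ∅ ⁻¹' F w with ht₁
  have hFm : ∀ w, MeasurableSet (F w) := measurableSet_fib Λf
  have ht₀m : ∀ w, MeasurableSet (t₀ w) := fun w => CouplingToLimits.measurable_obs _ (hFm w)
  have ht₁m : ∀ w, MeasurableSet (t₁ w) := fun w => CouplingToLimits.measurable_obs _ (hFm w)
  -- the masses of the fibres
  have hm₀ : ∀ w, π (F w ×ˢ Set.univ) = μIK (t₀ w) := by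
    intro w
    rw [Set.prod_univ, ← Measure.map_apply measurable_fst (hFm w), h1,
      hw₀ _ (hFm w) (fib_mem_determinedOn Λf w), νmix,
      Measure.map_apply (CouplingToLimits.measurable_obs _) (hFm w)]
  have hm₁ : ∀ w, π (Set.univ ×ˢ F w) = μIK (t₁ w) := by
    intro w
    rw [Set.univ_prod, ← Measure.map_apply measurable_snd (hFm w), h2,
      hw₁ _ (hFm w) (fib_mem_determinedOn Λf w), νmix,
      Measure.map_apply (CouplingToLimits.measurable_obs _) (hFm w)]
  -- the coupling
  set c : (Finset (Site 2) × Finset (Site 2)) × (Finset (Site 2) × Finset (Site 2)) → ℝ≥0∞ :=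
    fun w => π (F w.1 ×ˢ F w.2) * ((μIK (t₀ w.1))⁻¹ * (μIK (t₁ w.2))⁻¹) with hc
  set γ : Measure (Ω × Ω) :=
    ∑ w ∈ P ×ˢ P, c w • (μIK.restrict (t₀ w.1)).prod (μIK.restrict (t₁ w.2)) with hγ
  refine ⟨γ, ?_, ?_, ?_⟩
  · -- first marginal
    refine Measure.ext fun s hs => ?_
    rw [Measure.map_apply measurable_fst hs, hγ, Measure.finsetSum_apply]
    simp only [Measure.smul_apply, smul_eq_mul]
    have hterm : ∀ w ∈ P ×ˢ P,
        c w * ((μIK.restrict (t₀ w.1)).prod (μIK.restrict (t₁ w.2))) (Prod.fst ⁻¹' s) =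
          π (F w.1 ×ˢ F w.2) * ((μIK (t₀ w.1))⁻¹ * μIK (s ∩ t₀ w.1)) := by
      intro w _
      rw [← Measure.map_apply measurable_fst hs, Measure.map_fst_prod, Measure.smul_apply,
        smul_eq_mul, Measure.restrict_apply_univ, Measure.restrict_apply hs]
      have hle : π (F w.1 ×ˢ F w.2) ≤ μIK (t₁ w.2) := by
        rw [← hm₁]; exact measure_mono (Set.prod_mono (Set.subset_univ _) le_rfl)
      exact ennreal_rearr_fst hle (measure_ne_top _ _)
    rw [Finset.sum_congr rfl hterm, Finset.sum_product]
    have hrow : ∀ w₁ ∈ P, (∑ w₂ ∈ P, π (F (w₁, w₂).1 ×ˢ F (w₁, w₂).2) *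
        ((μIK (t₀ (w₁, w₂).1))⁻¹ * μIK (s ∩ t₀ (w₁, w₂).1))) = μIK (s ∩ t₀ w₁) := by
      intro w₁ _
      dsimp only
      rw [← Finset.sum_mul, sum_measure_fib_row Λf π (F w₁), hm₀]
      exact ennreal_mul_inv_mul (measure_mono Set.inter_subset_right) (measure_ne_top _ _)
    rw [Finset.sum_congr rfl hrow]
    -- the fibres partition `Ω`
    have key := sum_measure_fib Λf ((μIK.restrict s).map (obs Set.univ))
    have hmap : ∀ w, ((μIK.restrict s).map (obs Set.univ)) (fib Λf w) = μIK (s ∩ t₀ w) := by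
      intro w
      rw [Measure.map_apply (CouplingToLimits.measurable_obs _) (hFm w),
        Measure.restrict_apply (ht₀m w), Set.inter_comm]
    have huniv : ((μIK.restrict s).map (obs Set.univ)) Set.univ = μIK s := by
      rw [Measure.map_apply (CouplingToLimits.measurable_obs _) MeasurableSet.univ, Set.preimage_univ,
        Measure.restrict_apply_univ]
    simpa only [hmap, huniv] using key
  · -- second marginal
    refine Measure.ext fun s hs => ?_
    rw [Measure.map_apply measurable_snd hs, hγ, Measure.finsetSum_apply]
    simp only [Measure.smul_apply, smul_eq_mul]
    have hterm : ∀ w ∈ P ×ˢ P,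
        c w * ((μIK.restrict (t₀ w.1)).prod (μIK.restrict (t₁ w.2))) (Prod.snd ⁻¹' s) =
          π (F w.1 ×ˢ F w.2) * ((μIK (t₁ w.2))⁻¹ * μIK (s ∩ t₁ w.2)) := by
      intro w _
      rw [← Measure.map_apply measurable_snd hs, Measure.map_snd_prod, Measure.smul_apply,
        smul_eq_mul, Measure.restrict_apply_univ, Measure.restrict_apply hs]
      have hle : π (F w.1 ×ˢ F w.2) ≤ μIK (t₀ w.1) := by
        rw [← hm₀]; exact measure_mono (Set.prod_mono le_rfl (Set.subset_univ _))
      exact ennreal_rearr_snd hle (measure_ne_top _ _)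
    rw [Finset.sum_congr rfl hterm, Finset.sum_product_right]
    have hcol : ∀ w₂ ∈ P, (∑ w₁ ∈ P, π (F (w₁, w₂).1 ×ˢ F (w₁, w₂).2) *
        ((μIK (t₁ (w₁, w₂).2))⁻¹ * μIK (s ∩ t₁ (w₁, w₂).2))) = μIK (s ∩ t₁ w₂) := by
      intro w₂ _
      dsimp only
      rw [← Finset.sum_mul, sum_measure_fib_col Λf π (F w₂), hm₁]
      exact ennreal_mul_inv_mul (measure_mono Set.inter_subset_right) (measure_ne_top _ _)
    rw [Finset.sum_congr rfl hcol]
    have key := sum_measure_fib Λf ((μIK.restrict s).map (obs ∅))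
    have hmap : ∀ w, ((μIK.restrict s).map (obs ∅)) (fib Λf w) = μIK (s ∩ t₁ w) := by
      intro w
      rw [Measure.map_apply (CouplingToLimits.measurable_obs _) (hFm w),
        Measure.restrict_apply (ht₁m w), Set.inter_comm]
    have huniv : ((μIK.restrict s).map (obs ∅)) Set.univ = μIK s := by
      rw [Measure.map_apply (CouplingToLimits.measurable_obs _) MeasurableSet.univ, Set.preimage_univ,
        Measure.restrict_apply_univ]
    simpa only [hmap, huniv] using key
  · -- the bad event
    set Bpre : Set (Ω × Ω) := (fun ωω' : Ω × Ω => (obs Set.univ ωω'.1, obs ∅ ωω'.2)) ⁻¹' B with hBpre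
    rw [hγ, Measure.finsetSum_apply]
    simp only [Measure.smul_apply, smul_eq_mul]
    have hterm : ∀ w ∈ P ×ˢ P,
        c w * ((μIK.restrict (t₀ w.1)).prod (μIK.restrict (t₁ w.2))) Bpre ≤
          (π.restrict B) (F w.1 ×ˢ F w.2) := by
      intro w _
      rw [Measure.restrict_apply ((hFm w.1).prod (hFm w.2))]
      by_cases hBw : ∃ xx ∈ F w.1 ×ˢ F w.2, xx ∈ B
      · -- the whole product fibre lies in `B`
        obtain ⟨zz, hzz, hzzB⟩ := hBw
        have hsub : F w.1 ×ˢ F w.2 ⊆ B := by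
          rintro ⟨x, x'⟩ ⟨hx, hx'⟩
          exact (hB zz.1 x zz.2 x' (agree_of_mem_fib Λf hzz.1 hx) (agree_of_mem_fib Λf hzz.2 hx')).1 hzzB
        rw [Set.inter_eq_left.2 hsub]
        calc c w * ((μIK.restrict (t₀ w.1)).prod (μIK.restrict (t₁ w.2))) Bpre
            ≤ c w * ((μIK.restrict (t₀ w.1)).prod (μIK.restrict (t₁ w.2))) Set.univ := by
              gcongr; exact Set.subset_univ _
          _ = π (F w.1 ×ˢ F w.2) * ((μIK (t₀ w.1))⁻¹ * (μIK (t₁ w.2))⁻¹ * (μIK (t₀ w.1) * μIK (t₁ w.2))) := by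
              rw [← Set.univ_prod_univ, Measure.prod_prod, Measure.restrict_apply_univ,
                Measure.restrict_apply_univ, hc, mul_assoc]
          _ ≤ π (F w.1 ×ˢ F w.2) * 1 := by gcongr; exact ennreal_inv_inv_mul_mul_le_one _ _
          _ = π (F w.1 ×ˢ F w.2) := mul_one _
      · -- no pair of the product fibre lies in `B`: the term vanishes
        have hdisj : Bpre ⊆ (t₀ w.1 ×ˢ t₁ w.2)ᶜ := by
          rintro ⟨ω, ω'⟩ hωB ⟨hω, hω'⟩
          exact hBw ⟨(obs Set.univ ω, obs ∅ ω'), ⟨hω, hω'⟩, hωB⟩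
        have hzero : ((μIK.restrict (t₀ w.1)).prod (μIK.restrict (t₁ w.2))) Bpre = 0 := by
          refine le_antisymm ((measure_mono hdisj).trans (le_of_eq ?_)) bot_le
          refine Measure.measure_prod_compl_eq_zero ?_ ?_
          · rw [Measure.restrict_apply (ht₀m _).compl, Set.compl_inter_self, measure_empty]
          · rw [Measure.restrict_apply (ht₁m _).compl, Set.compl_inter_self, measure_empty]
        rw [hzero, mul_zero]
        exact bot_le
    calc ∑ w ∈ P ×ˢ P, c w * ((μIK.restrict (t₀ w.1)).prod (μIK.restrict (t₁ w.2))) Bpre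
        ≤ ∑ w ∈ P ×ˢ P, (π.restrict B) (F w.1 ×ˢ F w.2) := Finset.sum_le_sum hterm
      _ = (π.restrict B) Set.univ := sum_measure_fib_prod Λf (π.restrict B)
      _ = π B := Measure.restrict_apply_univ _

end Glue

/-- Sup-balls are finite. [folklore] -/
theorem ballInf_finite (v : Site 2) (R : ℕ) : (ballInf v R).Finite := by
  have hinj : Set.InjOn (fun w : Site 2 => (w 0, w 1)) (ballInf v R) := by
    intro w _ w' _ h
    simp only [Prod.mk.injEq] at h
    ext i
    fin_cases i
    · exact h.1
    · exact h.2
  refine Set.Finite.of_finite_image ?_ hinj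
  refine ((Set.finite_Icc (v 0 - R) (v 0 + R)).prod (Set.finite_Icc (v 1 - R) (v 1 + R))).subset ?_
  rintro _ ⟨w, hw, rfl⟩
  simp only [ballInf, Set.mem_setOf_eq, abs_le] at hw
  simp only [Set.mem_prod, Set.mem_Icc]
  omega

end Lift

/-! ## Piece S₃ — the coupling lift -/

/-- PIECE S₃ · `couplingLift` (PROVED) — LIFT OF AN OBSERVABLE COUPLING TO THE GAUGE: for `K, ε, ρ`
there is a block scale `A > 0` (`Lift.liftScale K ε ρ = |ε| + (‖K‖ + ‖K⁻¹‖ + 1)|ρ| + 2`) such that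
for every mesh `0 < δ ≤ 1`, every pair of patterns whose observables have the window laws of `S = univ`,
resp. `S = ∅`, on the sup-ball of radius `⌈A/δ⌉`, and every coupling `π` of `ν_{S₀}` with `ν_{S₁}`,
some coupling `γ` of `μIK` with `μIK` has `γ (badPair K δ ε ρ) ≤ π (badObs K δ ε ρ)`
(`Lift.badObs_congr`: the bad event is read on the ball; `Lift.glue`: conditioning on the finite
window partition). [folklore] -/
theorem couplingLift :
    ∀ (K : ℂ ≃L[ℝ] ℂ) (ε ρ : ℝ), ∃ A : ℝ, 0 < A ∧ ∀ δ : ℝ, 0 < δ → δ ≤ 1 →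
      ∀ (S₀ S₁ : Set ℤ) (π : Measure (Obs × Obs)),
        π.map Prod.fst = νmix S₀ → π.map Prod.snd = νmix S₁ →
        (∀ E : Set Obs, MeasurableSet E → E ∈ determinedOn (ballInf 0 ⌈A / δ⌉₊) →
          νmix S₀ E = νmix Set.univ E) →
        (∀ E : Set Obs, MeasurableSet E → E ∈ determinedOn (ballInf 0 ⌈A / δ⌉₊) →
          νmix S₁ E = νmix ∅ E) →
        ∃ γ : Measure (Ω × Ω), γ.map Prod.fst = μIK ∧ γ.map Prod.snd = μIK ∧
          γ (badPair K δ ε ρ) ≤ π (badObs K δ ε ρ) := by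
  intro K ε ρ
  refine ⟨Lift.liftScale K ε ρ, Lift.liftScale_pos K ε ρ, fun δ hδ hδ1 S₀ S₁ π h1 h2 hw₀ hw₁ => ?_⟩
  set R : ℕ := ⌈Lift.liftScale K ε ρ / δ⌉₊ with hR
  set Λf : Finset (Site 2) := (Lift.ballInf_finite 0 R).toFinset with hΛf
  have hcoe : (↑Λf : Set (Site 2)) = ballInf 0 R := Set.Finite.coe_toFinset _
  rw [badPair_eq_preimage_badObs]
  refine Lift.glue Λf h1 h2 (fun E hE hdet => hw₀ E hE (hcoe ▸ hdet)) (fun E hE hdet => hw₁ E hE (hcoe ▸ hdet))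
    fun x y x' y' hxy hxy' => ?_
  rw [hcoe] at hxy hxy'
  exact Lift.badObs_congr K ε ρ hδ hδ1 hxy hxy'

end Summit.CriticalPhenomena.CardyFormulaZ2.Theorems.IKLinearTransport.PinnedDiagramExchange

end
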